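import Mathlib
import Summits.ValiantsHypothesis.ValiantsHypothesis.Theorems.NewtonUnitEquationsDissociatedUniformTotalsLawConvexUnionSharpness
import HarnessLib

/-!
# Crux `NewtonUnitEquations.DissociatedUniform` (stmt-ValiantsHypothesis-5905): the TOTALS rung on the convexly ordered stratum — typed and located

Companion of `…TotalsLawConvexUnion` (pointwise rung `ConvexUnionVertBound C`: `#vert conv U_s(W) ≤ C·q` for both curves convexly
ordered) and `…TotalsLawConvexUnionSharpness` (`¬ ConvexUnionVertBound 2`: one class can carry `2q + 1`, indeed up to `4q − 2|W|`,
hull vertices).  The census of this seat (memo `Cruxes/DissociatedUniform/NOTES-t1g6.md` §4; script `exp/anneal_ut.py`: annealing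
BOTH polygon shapes and the position set, co- and contra-oriented pairs, `q ≤ 9`, plus random strictly convex pairs with one or two
fibres removed, `q ≤ 13`) finds that the pointwise excess is always COMPENSATED ACROSS THE CLASSES: the union total never exceeds
`2q²`, with equality at `Z = univ` (every class is then `A + B`).  So the located rung for the union totals law on this stratum is
the TOTALS statement with the sharp Minkowski constant:

* `@[conjecture] ConvexUnionTotalsBound C` : for all `q`, all convexly ordered `a b : ℤ/q → ℝ²` and every position set `Z`,
  `unionTotal a b Z ≤ C·q²` ("Minkowski on average over the `q` translates of `Z`").  Census: `C = 2` holds with equality cases;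
  OPEN; asserted nowhere.  (`UnionTotalsLaw C` of `…TotalsLawUnion` is the same inequality for ALL labellings and all groups.)
* `convexUnionTotalsBound_of_vertBound` (pointwise ⇒ totals, same constant), `two_le_of_convexUnionTotalsBound` (`C ≥ 2`: the
  unit square over `ℤ/2`), and the class-law consequence `totalVert_le_of_convexUnionTotalsBound`: an `m`-valued third curve over a
  convexly ordered pair has `T ≤ m·C·q²`.
Proved instances in the tree: few runs (`unionTotal_le_of_convexlyOrdered'`, constant `2 + #bdry Z`), all gaps `≤ L`
(`unionTotal_le_of_dense`, constant `4(L+1)`, injective curves), cosets / co-small sets (all labellings).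
Honest label: a typed conjecture + bookkeeping; nothing here bears on the open laws for general labellings or on VP ≠ VNP.
[folklore]
-/

set_option linter.dupNamespace false -- `ValiantsHypothesis.ValiantsHypothesis` (summit = problem) in every name

open scoped BigOperators Pointwise

namespace Summit.ValiantsHypothesis.ValiantsHypothesis.Theorems.NewtonUnitEquationsDissociatedUniform

namespace TotalsLaw

open Literature.Computability.AlgebraicComplexity.KPTT.PlanarMinkowski

/-- **Totals bound for fibre unions on the convexly ordered stratum** (conjecture-grade, OPEN; census of NOTES-t1g6 §4: `C = 2`
holds in all data, with equality at `Z = univ`): for both curves convexly ordered and EVERY position set `Z`,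
`∑_s #vert conv U_s(Z) ≤ C·q²`.  Not asserted anywhere. -/
@[conjecture] def ConvexUnionTotalsBound (C : ℕ) : Prop :=
  ∀ (q : ℕ) [NeZero q] (a b : ZMod q → (Fin 2 → ℝ)), ConvexlyOrdered a → ConvexlyOrdered b →
    ∀ Z : Finset (ZMod q), unionTotal a b (Z : Set (ZMod q)) ≤ C * q ^ 2

/-- The pointwise rung implies the totals rung with the same constant. -/
theorem convexUnionTotalsBound_of_vertBound {C : ℕ} (h : ConvexUnionVertBound C) : ConvexUnionTotalsBound C :=
  fun _ _ a b ha hb Z => unionTotal_le_of_convexUnionVertBound h a b ha hb Z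

/-- **`C ≥ 2` is necessary** in the totals rung: for the unit-square letters over `ℤ/2` and `Z = univ` both classes are the unit
square, `unionTotal = 8 = 2q²`. -/
theorem two_le_of_convexUnionTotalsBound {C : ℕ} (h : ConvexUnionTotalsBound C) : 2 ≤ C := by
  have hA : ConvexlyOrdered sqA := fun _ => cycUnimodal_zmod_two _
  have hB : ConvexlyOrdered sqB := fun _ => cycUnimodal_zmod_two _
  have h8 := h 2 sqA sqB hA hB Finset.univ
  have h4 : (2 : ℕ) ^ 2 = 4 := by norm_num
  rw [Finset.coe_univ, h4] at h8
  have hle : 8 ≤ unionTotal sqA sqB (Set.univ : Set (ZMod 2)) := by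
    unfold unionTotal
    calc 8 = ∑ _s : ZMod 2, 4 := by simp
      _ ≤ ∑ s : ZMod 2, unionVert sqA sqB (Set.univ : Set (ZMod 2)) s :=
          Finset.sum_le_sum fun s _ => by
            rw [unionVert_univ_eq_classVert_zero]
            exact four_le_classVert s
  omega

/-- **The totals rung gives the `n = 3` law on the `m`-valued stratum over a convexly ordered pair**: if `c` takes at most `m`
values, `T(a, b, c) ≤ m·C·q²` (level-set decomposition `totalVert_le_sum_unionTotal`). -/
theorem totalVert_le_of_convexUnionTotalsBound {C : ℕ} (h : ConvexUnionTotalsBound C) {q : ℕ} [NeZero q]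
    (a b c : ZMod q → (Fin 2 → ℝ)) (ha : ConvexlyOrdered a) (hb : ConvexlyOrdered b) [DecidableEq (Fin 2 → ℝ)] {m : ℕ}
    (hm : (Finset.univ.image c).card ≤ m) : totalVert a b c ≤ m * C * q ^ 2 := by
  classical
  have hlevel : ∀ v : Fin 2 → ℝ, unionTotal a b (c ⁻¹' {v}) ≤ C * q ^ 2 := by
    intro v
    have hset : (c ⁻¹' {v} : Set (ZMod q)) = ((Finset.univ.filter fun z => c z = v : Finset (ZMod q)) : Set (ZMod q)) := by
      ext z; simp
    rw [hset]
    exact h q a b ha hb _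
  calc totalVert a b c ≤ ∑ v ∈ Finset.univ.image c, unionTotal a b (c ⁻¹' {v}) := totalVert_le_sum_unionTotal a b c
    _ ≤ ∑ _v ∈ Finset.univ.image c, C * q ^ 2 := Finset.sum_le_sum fun v _ => hlevel v
    _ = (Finset.univ.image c).card * (C * q ^ 2) := by rw [Finset.sum_const, smul_eq_mul]
    _ ≤ m * (C * q ^ 2) := Nat.mul_le_mul_right _ hm
    _ = m * C * q ^ 2 := by ring

end TotalsLaw

end Summit.ValiantsHypothesis.ValiantsHypothesis.Theorems.NewtonUnitEquationsDissociatedUniform
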